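import Literature.Analysis.FluidPDE.CKNMorreyHolderProofs
import Literature.Analysis.FluidPDE.MultiplierHeatKernelDecay
import HarnessLib

/-!
# Lemarié-Rieusset 2016, Lemma 13.6: the discharge

`Proofs`-style file (theorems only: no definitions, no named facts). It closes the named fact
`Literature.Analysis.FluidPDE.LemarieRieusset2016.lemma13_6` of `CKNMorreyLemmas.lean` by
composing two theorems already in the tree:

* `lemma13_6_of_duhamel_holds : lemma13_6_duhamel → lemma13_6` (`MultiplierHeatKernelDecay`;
  Prop. 13.4 proved, `prop13_4_holds`), and
* `lemma13_6_duhamel_holds : lemma13_6_duhamel` (`CKNMorreyHolderProofs`; the localised Duhamel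
  representation (13.50)–(13.52)).

## References

* P. G. Lemarié-Rieusset, *The Navier–Stokes Problem in the 21st Century*, CRC Press (2016),
  Lemma 13.6 p. 477; §13.9 Step 3 (13.50)–(13.52) pp. 474–475; Prop. 13.4 p. 464.
  [cite: LemarieRieusset2016, Lemma 13.6 p. 477]
-/

namespace Literature.Analysis.FluidPDE

namespace LemarieRieusset2016

/-- **Lemarié-Rieusset 2016, Lemma 13.6 (Hölder regularity on `Q_{r₃}`), proved**: the named fact
`lemma13_6`, from the localised Duhamel formula (`lemma13_6_duhamel_holds`) and Prop. 13.4
(`prop13_4_holds`, inside `lemma13_6_of_duhamel_holds`). [cite: LemarieRieusset2016, Lemma 13.6 p. 477] -/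
theorem lemma13_6_holds : lemma13_6 :=
  lemma13_6_of_duhamel_holds lemma13_6_duhamel_holds

end LemarieRieusset2016

end Literature.Analysis.FluidPDE
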